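import Summits.BirchSwinnertonDyer.BirchSwinnertonDyer.Theorems.ErratumRoadFiveShimuraKolyvaginOrderBoundInertKeyRelation
import HarnessLib

/-!
# Route `ErratumRoadFive`, crux `ShimuraKolyvaginOrderBoundInertFromFive` (item
# stmt-BirchSwinnertonDyer-19718) — CARRIER GLUE: the per-level clauses of `hpointsR` (rationality,
# admissibility, inertia off `m`, `P_m ∈ invPoints`, Gross 5.4 (1) eigen relation, `τ̃`-stability) for
# ABSTRACT ring-class Euler-system data in x11b3's telescope

Cell `bsd-stepL`, seat `bsd-stepL-shim-p1` (prover g7), HELPER for the crux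
`Summit.BirchSwinnertonDyer.BirchSwinnertonDyer.Theses.ErratumRoadFive.ShimuraKolyvaginOrderBoundInertFromFive`
(`--supports stmt-BirchSwinnertonDyer-19718 --as helper`; K2 route `route-BirchSwinnertonDyer-ErratumRoadFive`
rev 19; skeleton v2 df9d5864b1b31f6b, stub S1 `stub_inert_unitIndex`). Fifth file of the session; second
brick of the CARRIER side (memo HOME/shim/LOCAL-HALF-19718.md v2 §6, supplier table) after
`…InertKeyRelation` (p475855, clause (f)).

## What this file proves

The END `sha_primary_eq_zero_of_ringClassRationalPointsM` (p470900 §4) takes a ring-class Euler-system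
datum `hpointsR`; memo §6 fixes its currency as x11b3's ABSTRACT TELESCOPE — per Kolyvagin level `m`: a
group `𝒢` ("`Gal(K[m]/K)`") acting on a module `A₀` ("`E(K[m])`"), generators `σ ℓ` with
`σ ℓ ^ (ℓ+1) = 1`, the subgroup `H = G_m ≤ ⟨σ_ℓ⟩` with a coset section `f`, the point `y` ("`y_m`"), a
Galois map `π : Γ_K → 𝒢`, an equivariant embedding `j : A₀ → E(K̄)`, and the dictionary
`e : K[m] →ₐ[K] K̄`, `ρ : 𝒢 ↪ Aut(K[m])` — plus LABELS. This file supplies, for such data, every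
per-level clause of `hpointsR` except (f) (p475855) and (d) (p469959):
* §1 `smul_map_eq_self_of_galoisDictionary` — every `j a` is rational over `e(K[m])` (input `hArat` of
  p469959; x11b3's `hrat_of_galoisDictionary` for all of `A₀`).
* §2 `isAdmissible_range_of_galoisEquivariant` — `j(A₀)` is admissible for `n` (Gross L4.3 ∕ McCallum (5)),
  from `n`-torsion-freeness of `A₀` (x11b3's structure-free `torsionBy_pow_ringClassField_eq_bot`).
* §3 `map_kolyvaginPoint_mem_invPoints` — `j(P_m) ∈ invPoints` (McCallum (4), Gross 3.6) from the
  abstract `KolyvaginEuler.smul_kolyvaginPoint_sub_mem` and the trace label `htr` (= `h37` (1) + (3.3)).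
* §4 `exists_pointsMap_map_kolyvaginPoint_eq_of_prop53` — the eigen relation
  `τ̃ j(P_m) = ε(−1)^{f_m} j(P_m) + n B` (Gross 5.4 (1)) from `KolyvaginEuler.conj_kolyvaginPoint_sub_mem`,
  the dihedral law for `T = τ_m`, the label `h53` in `T`-currency, and the GEOMETRIC GLUE
  `hjτ : τ̃ (j a) = j (T (h a))` (x11b3's `RingClassConj` restriction lemma); `pointsMap_mem_range_of_glue`
  — `τ̃`-stability of `j(A₀)`.
* §5 `resGal_smul_map_eq_self_of_galoisDictionary` — local inertia off `m` fixes every `j a` (x11b3's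
  clause `hI`; §1 + p469959's `resGal_smul_eq_self_of_mem_inertia_of_ringClassRational`).

## Honest framing

THEOREMS ONLY (no `def`, no named fact, no `sorry`; axioms standard); short glue over the tree's
abstract Euler-system algebra (x11b3 ∕ Literature `KolyvaginEuler`). Nothing about `X_{N⁺,N⁻}` is
constructed: the labels `htr` (trace), `h53` (conjugation), the data `y`, `σ`, `f`, `e`, `ρ`, `T`, `hjτ`
remain inputs — for the Shimura line they come from the four printed primitives (Bertolini–Darmon 1996
§2.3–2.6, Prop. 2.6; Nekovář 2007 (4.8), (4.9)) and x11b3's structure-free ring-class theorems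
(`RingClassFieldConj.exists_conj_algEquiv`, `KolyvaginConj.exists_addMonoidHom_map_smul_eq_inv_smul`,
`KolyvaginTauEigen.mem_zsmulRange_of_isOfFinAddOrder`). What remains for the carrier after this file:
the bottom level (`P_1 = P`, `IsOfFinAddOrder (cP − εP)`) and the per-level ASSEMBLY of `hpointsR`
(x11b3's `hpoints_of_perLevelChoice` pattern) + the typer's primitives; item 19718 and S1 ∕ S2 stay OPEN
(K2's imported open input). BSD is not proved by any of this; no census number moves.

References: [cite: GrossLMS1991, §3, Prop. 3.6, §4 (4.1), Lemma 4.3, §5 Prop. 5.3, Prop. 5.4 (1),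
Prop. 6.2 (1)] [cite: McCallumLMS1991, §4 (4)–(5)] [cite: BertoliniDarmon1996, §2.4, Prop. 2.6]
[cite: Cox2013, §9.A] [cite: Kim2022HigherGZ, §2.1 and Thm. 4.3]. presearch: as `…InertMachineEntry`
(S1S2-ROAD §4 ∕ SHIM-T1 §7.5, corpus + galaxy); `lean search 'of_galoisDictionary|map_kolyvaginPoint_mem_invPoints|_of_prop53'`
→ only x11b3's concrete ∕ derived-point forms (`hrat_of_galoisDictionary`, `kolyvaginPoint_mem_invPoints_of_dvd`,
`pointsMap_derivedPoint_concrete_of_prop53`), keyed on `KolyvaginHeegnerData`.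
-/

noncomputable section

open scoped Classical Pointwise

set_option linter.dupNamespace false

namespace Summit.BirchSwinnertonDyer.BirchSwinnertonDyer.Theorems

open WeierstrassCurve Field NumberField IsDedekindDomain Finset
  Literature.NumberTheory.EllipticCurves Literature.NumberTheory.GaloisRepresentations
  Literature.NumberTheory.EllipticCurves.KolyvaginCocycle
  Literature.NumberTheory.EllipticCurves.KolyvaginEuler
  Literature.NumberTheory.EllipticCurves.RingClassField
  Summit.BirchSwinnertonDyer.Rank1Residual.X11b

variable {K : Type} [Field K] [NumberField K] {W : WeierstrassCurve ℚ}

/-! ### §1 The Galois dictionary ⇒ rationality of the whole module over the embedded field -/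

/-- **Every point of the module is rational over the embedded field.** Abstract datum (x11b3's
telescope): a group `𝒢` acting on `A₀` ("`Gal(K[m]/K)` on `E(K[m])`"), a Galois map `π : Γ_K → 𝒢` and an
equivariant embedding `j : A₀ → E(K̄)` (`j (π g • a) = g • j a`), a field `F/K` with a `K`-embedding
`e : F → K̄` and an injective `ρ : 𝒢 → Aut(F)` compatible with `π` (`τ • e x = e (ρ (π τ) x)`). Then every
`Φ ∈ Γ_K` fixing `e(F)` pointwise fixes every `j a` (`ρ (π Φ) = 1` by injectivity of `e`, so
`π Φ = 1`): the hypothesis `hArat` ∕ `hrat` of p469959 (`kolyvaginClass_mem_selmerLocalKer_of_ringClassRational`)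
and p464962. Same proof as x11b3's `KolyvaginH44.hrat_of_galoisDictionary` (stated there for the derived
point only). [cite: GrossLMS1991, §4 (4.1) "`P_n ∈ E(K_n)`"] -/
theorem smul_map_eq_self_of_galoisDictionary
    {𝒢 : Type*} [CommGroup 𝒢] {A₀ : Type*} [AddCommGroup A₀] [DistribMulAction 𝒢 A₀]
    (π : absoluteGaloisGroup K →* 𝒢) (j : A₀ →+ geomPoints (W.baseChange K))
    (hj : ∀ (g : absoluteGaloisGroup K) (a : A₀), j (π g • a) = g • j a)
    {F : Type*} [Field F] [Algebra K F] [Algebra ℚ F] (e : F →ₐ[K] AlgebraicClosure K)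
    (ρ : 𝒢 →* (F ≃ₐ[ℚ] F)) (hρ : Function.Injective ρ)
    (hπρ : ∀ (τ : absoluteGaloisGroup K) (x : F), τ • e x = e (ρ (π τ) x))
    (a : A₀) (Φ : absoluteGaloisGroup K) (hΦ : ∀ x : F, Φ • e x = e x) : Φ • j a = j a := by
  have h1 : ρ (π Φ) = 1 := by
    refine AlgEquiv.ext fun x ↦ ?_
    have h := hΦ x
    rw [hπρ] at h
    rw [AlgEquiv.one_apply]
    exact e.injective h
  have h2 : π Φ = 1 := hρ (by rw [h1, map_one])
  rw [← hj, h2, one_smul]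

/-! ### §2 Admissibility of the embedded module -/

/-- **The embedded module `j(A₀) ≤ E(K̄)` is admissible for `n`** (Gross 1991 Lemma 4.3 ∕ McCallum (5)
in the machine's currency `IsAdmissible`): `Γ_K`-stable by equivariance of `j`, and `n`-torsion-free
when `A₀` has no `n`-torsion (for `A₀ = E(K[m])`, `n = p^M`, `p` odd, `ρ̄_{E,p}` onto: x11b3's
structure-free `torsionBy_pow_ringClassField_eq_bot`) and `j` is injective.
[cite: GrossLMS1991, Lemma 4.3] [cite: McCallumLMS1991, §4 (5)] -/
theorem isAdmissible_range_of_galoisEquivariant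
    {𝒢 : Type*} [CommGroup 𝒢] {A₀ : Type*} [AddCommGroup A₀] [DistribMulAction 𝒢 A₀]
    (π : absoluteGaloisGroup K →* 𝒢) (j : A₀ →+ geomPoints (W.baseChange K))
    (hj : ∀ (g : absoluteGaloisGroup K) (a : A₀), j (π g • a) = g • j a)
    (hjinj : Function.Injective j) {n : ℤ} (hX : ∀ a : A₀, n • a = 0 → a = 0) :
    IsAdmissible (absoluteGaloisGroup K) j.range n := by
  refine ⟨fun g x hx ↦ ?_, fun x hx h0 ↦ ?_⟩
  · obtain ⟨b, rfl⟩ := hx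
    exact ⟨π g • b, hj g b⟩
  · obtain ⟨b, rfl⟩ := hx
    rw [← map_zsmul] at h0
    have hb : n • b = 0 := hjinj (by rw [h0, map_zero])
    rw [hX b hb, map_zero]

/-! ### §3 `P_m ∈ invPoints` (Gross 3.6 ∕ McCallum (4)) through the embedding -/

/-- **The embedded derived point lies in `invPoints`** (McCallum's (4): `P_m ∈ (E(K_m)/p^M)^{𝒢_m}`;
Gross 1991 Prop. 3.6 with (4.1)): from the ABSTRACT `KolyvaginEuler.smul_kolyvaginPoint_sub_mem`
(`γ P − P ∈ nA₀` for `γ ∈ 𝒢`, given `G_m ≤ ⟨σ_ℓ⟩`, `σ_ℓ^{ℓ+1} = 1`, `n ∣ ℓ + 1`, `Tr_ℓ y ∈ nA₀`) pushed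
through the equivariant embedding `j`: for `g ∈ Γ_K`, `g • jP − jP = j(π g • P − P) ∈ n · j(A₀)`.
The trace hypothesis `htr` is the label `h37` (1) (Gross Prop. 3.7 (1); for `X_{N⁺,N⁻}` Bertolini–Darmon
1996 §2.4, Nekovář 2007 (4.8)) with (3.3) `p^M ∣ a_ℓ`. [cite: McCallumLMS1991, §4 (4)]
[cite: GrossLMS1991, Prop. 3.6, §4 (4.1)] -/
theorem map_kolyvaginPoint_mem_invPoints
    {𝒢 : Type*} [CommGroup 𝒢] {A₀ : Type*} [AddCommGroup A₀] [DistribMulAction 𝒢 A₀]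
    {σ : ℕ → 𝒢} {L : Finset ℕ} {n : ℤ} {H : Subgroup 𝒢} [Fintype (𝒢 ⧸ H)] {f : 𝒢 ⧸ H → 𝒢}
    (hf : ∀ q, (f q : 𝒢 ⧸ H) = q) (hgen : H ≤ Subgroup.closure (σ '' (L : Set ℕ)))
    (hord : ∀ ℓ ∈ L, σ ℓ ^ (ℓ + 1) = 1) (hdvd : ∀ ℓ ∈ L, n ∣ ((ℓ + 1 : ℕ) : ℤ)) {y : A₀}
    (htr : ∀ ℓ ∈ L, grAct A₀ (traceElt (σ ℓ) ℓ) y ∈ zsmulRange A₀ n)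
    (π : absoluteGaloisGroup K →* 𝒢) (j : A₀ →+ geomPoints (W.baseChange K))
    (hj : ∀ (g : absoluteGaloisGroup K) (a : A₀), j (π g • a) = g • j a) :
    j (kolyvaginPoint σ L f y) ∈ invPoints (absoluteGaloisGroup K) j.range n := by
  refine ⟨⟨_, rfl⟩, fun g ↦ ?_⟩
  obtain ⟨a, ha⟩ := smul_kolyvaginPoint_sub_mem hf hgen hord hdvd htr (π g)
  refine ⟨j a, ⟨a, rfl⟩, ?_⟩
  change n • a = π g • kolyvaginPoint σ L f y - kolyvaginPoint σ L f y at ha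
  rw [← map_zsmul, ha, map_sub, hj]

/-! ### §4 Gross's Prop. 5.4 (1) through the embedding -/

/-- **The eigen relation `τ P_m = ε (−1)^{f_m} P_m + p^M B` for the embedded derived point** (clause
(Gross 5.4 (1)) of `hpointsR`), from the ABSTRACT `KolyvaginEuler.conj_kolyvaginPoint_sub_mem` and
`smul_kolyvaginPoint_sub_mem`. Inputs beyond §3's: an additive `T : A₀ → A₀` with the dihedral law
`T (γ a) = γ⁻¹ T a` (complex conjugation `τ_m` on `E(K[m])`, `τ_m γ τ_m⁻¹ = γ⁻¹` — x11b3's structure-free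
`KolyvaginConj.exists_addMonoidHom_map_smul_eq_inv_smul`), the label `h53` in `T`-currency
(`T y − ε σ' y ∈ nA₀`: Gross Prop. 5.3 ∕ Bertolini–Darmon 1996 Prop. 2.6 for `X_{N⁺,N⁻}`, the torsion
absorbed by Lemma 4.3 — x11b3's `KolyvaginTauEigen.mem_zsmulRange_of_isOfFinAddOrder`), and the
GEOMETRIC GLUE `hjτ : τ̃ (j a) = j (T (h • a))` for one `h ∈ 𝒢` (the lift `τ̃` of complex conjugation
restricts on `e(K[m])` to `τ_m ∘ h`: x11b3's `RingClassConj.exists_algEquiv_apply_emb_eq` ∕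
`pointsMap_toGeomPoints_eq`). Proof = the tail of x11b3's `KolyvaginTauEigen.pointsMap_derivedPoint_concrete_of_prop53`:
`τ̃ P = T(hP) = T(P + n a₁) = ε_m P + n a₂ + n T a₁`. [cite: GrossLMS1991, §5 Prop. 5.4 (1) and proof,
Prop. 5.3, §3] [cite: BertoliniDarmon1996, Prop. 2.6] -/
theorem exists_pointsMap_map_kolyvaginPoint_eq_of_prop53
    {𝒢 : Type*} [CommGroup 𝒢] {A₀ : Type*} [AddCommGroup A₀] [DistribMulAction 𝒢 A₀]
    {σ : ℕ → 𝒢} {L : Finset ℕ} {n : ℤ} {H : Subgroup 𝒢} [Fintype (𝒢 ⧸ H)] {f : 𝒢 ⧸ H → 𝒢}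
    (hf : ∀ q, (f q : 𝒢 ⧸ H) = q) (hgen : H ≤ Subgroup.closure (σ '' (L : Set ℕ)))
    (hord : ∀ ℓ ∈ L, σ ℓ ^ (ℓ + 1) = 1) (hdvd : ∀ ℓ ∈ L, n ∣ ((ℓ + 1 : ℕ) : ℤ)) {y : A₀}
    (htr : ∀ ℓ ∈ L, grAct A₀ (traceElt (σ ℓ) ℓ) y ∈ zsmulRange A₀ n)
    (T : A₀ →+ A₀) (hT : ∀ (γ : 𝒢) (a : A₀), T (γ • a) = γ⁻¹ • T a)
    {ε : ℤ} {σ' : 𝒢} (hτy : T y - ε • σ' • y ∈ zsmulRange A₀ n)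
    (j : A₀ →+ geomPoints (W.baseChange K))
    {c : K ≃ₐ[ℚ] K} {τ : AlgebraicClosure K ≃+* AlgebraicClosure K} (hτ : IsLiftOfAut c τ)
    {h : 𝒢} (hjτ : ∀ a : A₀, hτ.pointsMap W (j a) = j (T (h • a))) :
    ∃ B ∈ j.range, hτ.pointsMap W (j (kolyvaginPoint σ L f y)) =
      (ε * (-1) ^ L.card) • j (kolyvaginPoint σ L f y) + n • B := by
  set P := kolyvaginPoint σ L f y with hPdef
  -- McCallum's (4) at `h` and Gross 5.4 (1) for `T`, in `A₀`
  obtain ⟨a₁, ha₁⟩ := smul_kolyvaginPoint_sub_mem hf hgen hord hdvd htr h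
  obtain ⟨a₂, ha₂⟩ := conj_kolyvaginPoint_sub_mem hf hgen hord hdvd htr T hT hτy
  change n • a₁ = h • P - P at ha₁
  change n • a₂ = T P - (ε * (-1) ^ L.card) • P at ha₂
  refine ⟨j (a₂ + T a₁), ⟨a₂ + T a₁, rfl⟩, ?_⟩
  have h1 : h • P = P + n • a₁ := by rw [ha₁]; abel
  have h2 : T P = (ε * (-1) ^ L.card) • P + n • a₂ := by rw [ha₂]; abel
  rw [hjτ, h1]
  simp only [map_add, map_zsmul, h2, smul_add]
  abel

/-- **`τ̃`-stability of the embedded module** (clause `hAτ` of `hpoints` ∕ `hpointsR`): with the glue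
`hjτ` of `exists_pointsMap_map_kolyvaginPoint_eq_of_prop53`, `τ̃` maps `j(A₀)` into itself.
[cite: GrossLMS1991, §5 (complex conjugation acts on `E(K_n)`)] -/
theorem pointsMap_mem_range_of_glue
    {𝒢 : Type*} [CommGroup 𝒢] {A₀ : Type*} [AddCommGroup A₀] [DistribMulAction 𝒢 A₀]
    (T : A₀ →+ A₀) (j : A₀ →+ geomPoints (W.baseChange K))
    {c : K ≃ₐ[ℚ] K} {τ : AlgebraicClosure K ≃+* AlgebraicClosure K} (hτ : IsLiftOfAut c τ)
    {h : 𝒢} (hjτ : ∀ a : A₀, hτ.pointsMap W (j a) = j (T (h • a)))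
    {x : geomPoints (W.baseChange K)} (hx : x ∈ j.range) : hτ.pointsMap W x ∈ j.range := by
  obtain ⟨a, rfl⟩ := hx
  exact ⟨T (h • a), (hjτ a).symm⟩

/-! ### §5 Local inertia off `m` fixes the embedded module -/

/-- **Local inertia at `v ∤ m` fixes every embedded point** (clause `hI` of x11b3's telescope and the
input of p469959 §1): with the Galois dictionary of §1 for `F = K[m] = ringClassField K ι m`, every
`t ∈ I_𝔐 ≤ Γ_{K_v}` (`m ∉ v`) has `res(t) • j a = j a` — §1 + `K[m]/K` unramified off `m`
(`resGal_smul_eq_self_of_mem_inertia_of_ringClassRational`, p469959; x11b3's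
`KolyvaginH44.resGal_smul_algHom_ringClassField_eq_self`). [cite: GrossLMS1991, Prop. 6.2 (1)]
[cite: Cox2013, §9.A] -/
theorem resGal_smul_map_eq_self_of_galoisDictionary (hK : IsImaginaryQuadratic K) (ι : K →+* ℂ)
    {m : ℕ} (hm : m ≠ 0)
    {𝒢 : Type*} [CommGroup 𝒢] {A₀ : Type*} [AddCommGroup A₀] [DistribMulAction 𝒢 A₀]
    (π : absoluteGaloisGroup K →* 𝒢) (j : A₀ →+ geomPoints (W.baseChange K))
    (hj : ∀ (g : absoluteGaloisGroup K) (a : A₀), j (π g • a) = g • j a)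
    (e : ringClassField K ι m →ₐ[K] AlgebraicClosure K)
    (ρ : 𝒢 →* (ringClassField K ι m ≃ₐ[ℚ] ringClassField K ι m)) (hρ : Function.Injective ρ)
    (hπρ : ∀ (τ : absoluteGaloisGroup K) (x : ringClassField K ι m), τ • e x = e (ρ (π τ) x))
    {v : HeightOneSpectrum (𝓞 K)} (hv : ((m : ℕ) : 𝓞 K) ∉ v.asIdeal)
    {𝔐 : Ideal (v.localAbsIntegers)} (h𝔐 : 𝔐 ∈ v.localPrimesAbove)
    {t : absoluteGaloisGroup (v.adicCompletion K)}
    (ht : t ∈ 𝔐.inertia (absoluteGaloisGroup (v.adicCompletion K))) (a : A₀) :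
    resGal (K := K) (v.adicCompletion K) t • j a = j a :=
  resGal_smul_eq_self_of_mem_inertia_of_ringClassRational hK ι hm e hv h𝔐
    (fun Φ hΦ ↦ smul_map_eq_self_of_galoisDictionary π j hj e ρ hρ hπρ a Φ hΦ) ht

end Summit.BirchSwinnertonDyer.BirchSwinnertonDyer.Theorems

end
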